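import Summits.ABC.ABC.Theorems.IsogenyGlueCongruencePolyHeightOfBoundedPrimes
import Summits.ABC.ABC.Theorems.IsogenyGlueCongruenceSharpDegreeOfPolyDegreeOfTarget
import Summits.ABC.ABC.Theorems.IsogenyGlueCongruenceSharpDegreeOfPolyDegreeOfAbc

-- `Summit.ABC.ABC.…`: summit and sub-problem share the name `ABC` (single-conjunct summit, D-0017).
set_option linter.dupNamespace false

/-!
# Item `SharpDegreeOfPolyHeight` (stmt-ABC-16009): logical position of the height-form residual

`R' := SharpDegreeOfPolyHeight = (H → X)` with `X = SemistableDegreeConjecture` (the route's target,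
stmt-ABC-2044) and `H` the polynomial height conjecture for semistable curves
(`∃ σ C, max(|Δ_W|, |c₄(W)|³) ≤ C · N_W^σ` on semistable globally minimal elliptic `W/ℚ`).  `R'` is the
route-choice re-cut (05c66fb8) of the crux `R := SharpDegreeOfPolyDegree = (P → X)` (stmt-ABC-10895),
`P` the polynomial modular-degree statement.  This support file (`--supports stmt-ABC-16009`) records,
kernel-checked, where `R'` sits; every statement is a few lines over LANDED theorems of the tree
(`polyDegree_of_polyHeight_of_manin`, `manin_of_polyDegree`, `polyDegree_iff_polyHeight_of_items`,
`SharpDegreeOfPolyDegree.poly_of_semistableDegreeConjecture`,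
`SharpDegreeOfPolyDegree.semistableDegreeConjecture_of_abc_of_facts`, `frameOverPetersson_proof`,
`polyHeight_of_generalizedSzpiroBG`, `abcLe_iff_generalizedSzpiroBG_holds`) and the two one-liners
already landed with item B' (`IsogenyGlueCongruencePolyHeightOfBoundedPrimes.lean`, stmt-ABC-16006):
`PolyHeightOfBoundedPrimes.sharpDegreeOfPolyHeight_of_semistableDegreeConjecture : X → R'` — the
closing move the day stmt-ABC-2044 lands — and
`PolyHeightOfBoundedPrimes.sharpDegreeOfPolyDegree_of_sharpDegreeOfPolyHeight : R' → R`.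

Unconditional:
* the EXACT relation `iff_sharpDegreeOfPolyDegree_and_manin : R' ↔ R ∧ (H → M)`, `M` = polynomially
  bounded Manin constants of SOME datum of every semistable curve (so `M` contains modularity): `R'`
  is `R` plus the obligation to produce modular parametrisations with controlled Manin constant out
  of `H` alone (`of_sharpDegreeOfPolyDegree_of_manin` is the `←` half).
* `iff_target_of_polyHeight : H → (R' ↔ X)`, `of_not_polyHeight : ¬ H → R'`,
  `not_iff : ¬ R' ↔ H ∧ ¬ X` — a refutation of `R'` must PROVE polynomial Szpiro for all semistable
  curves and refute the target.
* `polyHeight_of_abc : ABC → H` (Bombieri–Gubler Thm. 12.5.12 (a) ⟹ (c), proved in the tree, restricted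
  to semistable global minimal models) — so the vacuous road to `R'` (`¬ H`) is closed unless the summit
  itself is false: `not_abc_of_not_polyHeight`.

Modulo the named inputs of modularity / Manin / Mazur–Kenku type (all known in print):
* `of_sharpDegreeOfPolyDegree_of_items`, `iff_sharpDegreeOfPolyDegree_of_items` : `R ↔ R'` modulo
  {`EdixhovenIntegrality` (stmt-ABC-15990, Edixhoven 1991 Prop. 2), Česnavičius 2018 Thm. 1.2,
  `MazurKenkuBound` (stmt-ABC-15125), `ModularDatumExists` (stmt-ABC-15126)}.
* `of_abc_of_facts : ABC → R'` and `iff_polyHeight_imp_abc_of_facts : R' ↔ (H → ABC)`,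
  `iff_polyHeight_iff_abc_of_facts : R' ↔ (H ↔ ABC)` modulo {`PeterssonLowerBound` (stmt-ABC-10870),
  `exists_optimal_modularParametrizationData`, `abs_maninConstant_eq_one_of_isSemistable`,
  `MazurKenkuBound`}: the item says precisely that polynomial Szpiro (height form, semistable curves)
  is ALREADY as strong as abc — the declared abc-strength residual; no amplification from a free
  exponent `σ` to `6 + ε` is known, and none of the route's mechanisms addresses it.

Conclusion recorded for the planner: `R'` closes by
`PolyHeightOfBoundedPrimes.sharpDegreeOfPolyHeight_of_semistableDegreeConjecture` when `X`
(stmt-ABC-2044) lands and is otherwise blocked on it, exactly as `R`.  Theorems only; no definitions,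
no new named facts.
-/

noncomputable section

namespace Summit.ABC.ABC.Theorems.SharpDegreeOfPolyHeight

open Summit.ABC.ABC.Theses.IsogenyGlueCongruence
open Literature.NumberTheory.EllipticCurves Literature.NumberTheory.EllipticCurves.ModularForms
open Literature.NumberTheory.DiophantineGeometry Literature.NumberTheory.Automorphic
open WeierstrassCurve

/-! ## Positive side: relation to `R` -/

/-- **`(H → M) → R → R'`**: if the height statement `H` yields polynomially bounded Manin data `M`
(hence modularity of every semistable curve), then `H ∧ M → P` (`polyDegree_of_polyHeight_of_manin`)
and `R = (P → X)` gives `X`. [folklore] -/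
theorem of_sharpDegreeOfPolyDegree_of_manin
    (hHM : (∃ σ C : ℝ, ∀ (W : WeierstrassCurve ℚ) [W.IsElliptic] [W.IsGloballyMinimal]
        [NeZero (W.conductorNorm ℤ)], W.IsSemistable ℤ →
        ((max |W.Δ| (|W.c₄| ^ 3) : ℚ) : ℝ) ≤ C * (W.conductorNorm ℤ : ℝ) ^ σ) →
      ∃ a M₀ : ℝ, ∀ (W : WeierstrassCurve ℚ) [W.IsElliptic] [W.IsGloballyMinimal]
        [NeZero (W.conductorNorm ℤ)], W.IsSemistable ℤ →
        ∃ D : ModularParametrizationData W (W.conductorNorm ℤ),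
          |(D.maninConstant : ℝ)| ≤ M₀ * (W.conductorNorm ℤ : ℝ) ^ a)
    (hR : SharpDegreeOfPolyDegree) : SharpDegreeOfPolyHeight :=
  fun hH => hR (polyDegree_of_polyHeight_of_manin hH (hHM hH))

/-- **Exact position of `R'` relative to `R`: `R' ↔ R ∧ (H → M)`**, unconditionally.  `→`: `R' → R`
(`PolyHeightOfBoundedPrimes.sharpDegreeOfPolyDegree_of_sharpDegreeOfPolyHeight`, through `P → H`) and,
granted `H`, `R'` gives `X`, `X → P` (exponent `3`,
`SharpDegreeOfPolyDegree.poly_of_semistableDegreeConjecture`) and `P → M` (`manin_of_polyDegree`).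
`←`: `of_sharpDegreeOfPolyDegree_of_manin`.  So the height-form re-cut is the crux `R` together with
the obligation "`H` alone produces modular parametrisations with polynomially bounded Manin constant",
which is where the modularity / Manin input of the old chain now sits. [folklore] -/
theorem iff_sharpDegreeOfPolyDegree_and_manin :
    SharpDegreeOfPolyHeight ↔
      (SharpDegreeOfPolyDegree ∧
        ((∃ σ C : ℝ, ∀ (W : WeierstrassCurve ℚ) [W.IsElliptic] [W.IsGloballyMinimal]
            [NeZero (W.conductorNorm ℤ)], W.IsSemistable ℤ →
            ((max |W.Δ| (|W.c₄| ^ 3) : ℚ) : ℝ) ≤ C * (W.conductorNorm ℤ : ℝ) ^ σ) →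
          ∃ a M₀ : ℝ, ∀ (W : WeierstrassCurve ℚ) [W.IsElliptic] [W.IsGloballyMinimal]
            [NeZero (W.conductorNorm ℤ)], W.IsSemistable ℤ →
            ∃ D : ModularParametrizationData W (W.conductorNorm ℤ),
              |(D.maninConstant : ℝ)| ≤ M₀ * (W.conductorNorm ℤ : ℝ) ^ a)) :=
  ⟨fun h =>
      ⟨Summit.ABC.ABC.Theorems.PolyHeightOfBoundedPrimes.sharpDegreeOfPolyDegree_of_sharpDegreeOfPolyHeight
          h,
        fun hH => manin_of_polyDegree
          (Summit.ABC.ABC.Theorems.SharpDegreeOfPolyDegree.poly_of_semistableDegreeConjecture (h hH))⟩,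
    fun h => of_sharpDegreeOfPolyDegree_of_manin h.2 h.1⟩

/-- **`R → R'` modulo the four items/facts of the optimal-curve calibration**: the route items
`EdixhovenIntegrality` (stmt-ABC-15990, verbatim Edixhoven 1991 Prop. 2 in lattice form),
`MazurKenkuBound` (stmt-ABC-15125), `ModularDatumExists` (stmt-ABC-15126) and Česnavičius 2018
Thm. 1.2 give `P ↔ H` (`polyDegree_iff_polyHeight_of_items`).
[cite: MurtyCongruencePrimes1999, Thm. 1 (ii) and §2] -/
theorem of_sharpDegreeOfPolyDegree_of_items
    (hEd : EdixhovenIntegrality)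
    (hCes : ∀ {W' : WeierstrassCurve ℚ} {N' : ℕ} [NeZero N']
      (D' : ModularParametrizationData W' N'), D'.abs_maninConstant_eq_one_of_isSemistable)
    (hMK : MazurKenkuBound) (hMod : ModularDatumExists) (hR : SharpDegreeOfPolyDegree) :
    SharpDegreeOfPolyHeight :=
  fun hH => hR ((polyDegree_iff_polyHeight_of_items hEd hCes hMK hMod).mpr hH)

/-- **`R' ↔ R` modulo the same four inputs** (`→` is unconditional). [cite: MurtyCongruencePrimes1999, Thm. 1 (ii) and §2] -/
theorem iff_sharpDegreeOfPolyDegree_of_items (hEd : EdixhovenIntegrality)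
    (hCes : ∀ {W' : WeierstrassCurve ℚ} {N' : ℕ} [NeZero N']
      (D' : ModularParametrizationData W' N'), D'.abs_maninConstant_eq_one_of_isSemistable)
    (hMK : MazurKenkuBound) (hMod : ModularDatumExists) :
    SharpDegreeOfPolyHeight ↔ SharpDegreeOfPolyDegree :=
  ⟨Summit.ABC.ABC.Theorems.PolyHeightOfBoundedPrimes.sharpDegreeOfPolyDegree_of_sharpDegreeOfPolyHeight,
    of_sharpDegreeOfPolyDegree_of_items hEd hCes hMK hMod⟩

/-- **Under `H`, `R'` is `X`.** [folklore] -/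
theorem iff_target_of_polyHeight
    (hH : ∃ σ C : ℝ, ∀ (W : WeierstrassCurve ℚ) [W.IsElliptic] [W.IsGloballyMinimal]
      [NeZero (W.conductorNorm ℤ)], W.IsSemistable ℤ →
      ((max |W.Δ| (|W.c₄| ^ 3) : ℚ) : ℝ) ≤ C * (W.conductorNorm ℤ : ℝ) ^ σ) :
    SharpDegreeOfPolyHeight ↔ SemistableDegreeConjecture :=
  ⟨fun h => h hH,
    Summit.ABC.ABC.Theorems.PolyHeightOfBoundedPrimes.sharpDegreeOfPolyHeight_of_semistableDegreeConjecture⟩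

/-- **Without `H`, `R'` holds vacuously.** [folklore] -/
theorem of_not_polyHeight
    (h : ¬ ∃ σ C : ℝ, ∀ (W : WeierstrassCurve ℚ) [W.IsElliptic] [W.IsGloballyMinimal]
      [NeZero (W.conductorNorm ℤ)], W.IsSemistable ℤ →
      ((max |W.Δ| (|W.c₄| ^ 3) : ℚ) : ℝ) ≤ C * (W.conductorNorm ℤ : ℝ) ^ σ) :
    SharpDegreeOfPolyHeight := fun hH => absurd hH h

/-! ## Negative side: what a disproof must contain -/

/-- **`¬ R' ↔ H ∧ ¬ X`**: a disproof of the item is a PROOF of the polynomial height conjecture for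
all semistable curves together with a refutation of the target. [folklore] -/
theorem not_iff :
    ¬ SharpDegreeOfPolyHeight ↔
      ((∃ σ C : ℝ, ∀ (W : WeierstrassCurve ℚ) [W.IsElliptic] [W.IsGloballyMinimal]
          [NeZero (W.conductorNorm ℤ)], W.IsSemistable ℤ →
          ((max |W.Δ| (|W.c₄| ^ 3) : ℚ) : ℝ) ≤ C * (W.conductorNorm ℤ : ℝ) ^ σ) ∧
        ¬ SemistableDegreeConjecture) := by
  unfold SharpDegreeOfPolyHeight
  exact Classical.not_imp

/-- **The summit implies the antecedent: `ABC → H`** (with `σ = 7`).  abc in the summit's strict form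
gives the `≤`-form, which is equivalent to the Bombieri–Gubler generalized Szpiro conjecture
(`abcLe_iff_generalizedSzpiroBG_holds`, Thm. 12.5.12, proved in the tree), which restricted to
semistable global minimal models is `H` (`polyHeight_of_generalizedSzpiroBG`).  Hence the vacuous road
to `R'` (refuting `H`) is closed unless the summit is false. [cite: BombieriGubler2006, Thm. 12.5.12] -/
theorem polyHeight_of_abc (h : ABC) :
    ∃ σ C : ℝ, ∀ (W : WeierstrassCurve ℚ) [W.IsElliptic] [W.IsGloballyMinimal]
      [NeZero (W.conductorNorm ℤ)], W.IsSemistable ℤ →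
      ((max |W.Δ| (|W.c₄| ^ 3) : ℚ) : ℝ) ≤ C * (W.conductorNorm ℤ : ℝ) ^ σ :=
  polyHeight_of_generalizedSzpiroBG (abcLe_iff_generalizedSzpiroBG_holds.mp
    (Summit.ABC.ABC.Theorems.SharpDegreeOfPolyDegree.abcLe_of_ABC h))

/-- **Refuting `H` refutes the summit.** [cite: BombieriGubler2006, Thm. 12.5.12] -/
theorem not_abc_of_not_polyHeight
    (h : ¬ ∃ σ C : ℝ, ∀ (W : WeierstrassCurve ℚ) [W.IsElliptic] [W.IsGloballyMinimal]
      [NeZero (W.conductorNorm ℤ)], W.IsSemistable ℤ →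
      ((max |W.Δ| (|W.c₄| ^ 3) : ℚ) : ℝ) ≤ C * (W.conductorNorm ℤ : ℝ) ^ σ) :
    ¬ ABC := fun habc => h (polyHeight_of_abc habc)

/-! ## The circle closed: `R' ⟺ (H → ABC) ⟺ (H ↔ ABC)` modulo the named inputs -/

/-- **`ABC → R'`** modulo the three named inputs of
`SharpDegreeOfPolyDegree.semistableDegreeConjecture_of_abc_of_facts` (optimal datum on a global minimal
model, Manin constant `±1` in the semistable case, `MazurKenkuBound`): the summit gives `X`, hence
`R'`. [cite: MurtyCongruencePrimes1999, Thm. 1 (ii)] -/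
theorem of_abc_of_facts (hOpt : exists_optimal_modularParametrizationData)
    (hc1 : ∀ {N : ℕ} [NeZero N] {W₀ : WeierstrassCurve ℚ} (D₀ : ModularParametrizationData W₀ N),
      D₀.abs_maninConstant_eq_one_of_isSemistable)
    (hMK : MazurKenkuBound) (h : ABC) : SharpDegreeOfPolyHeight := fun _ =>
  Summit.ABC.ABC.Theorems.SharpDegreeOfPolyDegree.semistableDegreeConjecture_of_abc_of_facts
    hOpt hc1 hMK h

/-- **The item is `H → ABC`** modulo {`PeterssonLowerBound` (stmt-ABC-10870),
`exists_optimal_modularParametrizationData`, `abs_maninConstant_eq_one_of_isSemistable`,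
`MazurKenkuBound` (stmt-ABC-15125)}: `R' = (H → X)` and `X ⟺ ABC` modulo these
(`SharpDegreeOfPolyDegree.semistableDegreeConjecture_iff_abc_of_facts`).  In words: "polynomial Szpiro
in height form for semistable curves implies abc" — the declared abc-strength residual.
[cite: MurtyCongruencePrimes1999, Thm. 1] -/
theorem iff_polyHeight_imp_abc_of_facts (hP : PeterssonLowerBound)
    (hOpt : exists_optimal_modularParametrizationData)
    (hc1 : ∀ {N : ℕ} [NeZero N] {W₀ : WeierstrassCurve ℚ} (D₀ : ModularParametrizationData W₀ N),
      D₀.abs_maninConstant_eq_one_of_isSemistable)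
    (hMK : MazurKenkuBound) :
    SharpDegreeOfPolyHeight ↔
      ((∃ σ C : ℝ, ∀ (W : WeierstrassCurve ℚ) [W.IsElliptic] [W.IsGloballyMinimal]
          [NeZero (W.conductorNorm ℤ)], W.IsSemistable ℤ →
          ((max |W.Δ| (|W.c₄| ^ 3) : ℚ) : ℝ) ≤ C * (W.conductorNorm ℤ : ℝ) ^ σ) → ABC) :=
  ⟨fun hR hH => Summit.ABC.ABC.Theorems.frameOverPetersson_proof hP (hR hH),
    fun h hH =>
      Summit.ABC.ABC.Theorems.SharpDegreeOfPolyDegree.semistableDegreeConjecture_of_abc_of_facts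
        hOpt hc1 hMK (h hH)⟩

/-- **The item is `H ↔ ABC`** modulo the same four named inputs, since `ABC → H` is unconditional
(`polyHeight_of_abc`): granted the known inputs, `SharpDegreeOfPolyHeight` asserts that the polynomial
height conjecture for semistable curves is already EQUIVALENT to the abc conjecture.
[cite: MurtyCongruencePrimes1999, Thm. 1] [cite: BombieriGubler2006, Thm. 12.5.12] -/
theorem iff_polyHeight_iff_abc_of_facts (hP : PeterssonLowerBound)
    (hOpt : exists_optimal_modularParametrizationData)
    (hc1 : ∀ {N : ℕ} [NeZero N] {W₀ : WeierstrassCurve ℚ} (D₀ : ModularParametrizationData W₀ N),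
      D₀.abs_maninConstant_eq_one_of_isSemistable)
    (hMK : MazurKenkuBound) :
    SharpDegreeOfPolyHeight ↔
      ((∃ σ C : ℝ, ∀ (W : WeierstrassCurve ℚ) [W.IsElliptic] [W.IsGloballyMinimal]
          [NeZero (W.conductorNorm ℤ)], W.IsSemistable ℤ →
          ((max |W.Δ| (|W.c₄| ^ 3) : ℚ) : ℝ) ≤ C * (W.conductorNorm ℤ : ℝ) ^ σ) ↔ ABC) :=
  (iff_polyHeight_imp_abc_of_facts hP hOpt hc1 hMK).trans
    ⟨fun h => ⟨h, polyHeight_of_abc⟩, fun h => h.mp⟩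

end Summit.ABC.ABC.Theorems.SharpDegreeOfPolyHeight

end
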